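/-
Copyright (c) 2026 the pub-hodgecm-mathlib formalisation cell (harness21).  Prover seat hodgecm-mathlib-K2E3-p24 (g2), HCML Track B «K2-LIT» ∕ h413 (`stmt-HodgeConjecture-24833`),
line «SC′-IRR-lev» (leaf (S-C′-irr) `sig_K2E3GL3TwoBlockInducedIrreducible`; lead K2E3-p24, dealer D82), brick JM-A part 2 (`r_Q(i_Q σ') ≅ σ'`).  2026-09-04.
-/
import Summits.HodgeConjecture.HodgeConjecture.Theorems.K2E3GL3CuspidalBlockBoxes   -- JM-A part 1 (this seat): boxes in `N'`, the shear on standard sections; brings K0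
import HarnessLib

/-!
# K2_E3 road (h413), line «SC′-IRR-lev», brick JM-A — the Jacquet module of `Ind_{P₍₂,₁₎}^{GL₃} σ'` along `P₍₂,₁₎` ITSELF is `σ'` (via evaluation at `1`),
# for `σ'` a smooth representation of `P₍₂,₁₎` whose space is spanned by the vectors `σ'(x₁₀(y)) w - w`

Cell `pub/hodgecm-mathlib` (D-0151), Track B, seat K2E3-p24 (g2) = LEAD of line «SC′-IRR-lev».  `--supports stmt-HodgeConjecture-24833 --as helper`; THEOREMS ONLY
(no definition ∕ instance ∕ notation ∕ named fact ∕ `sorry`); never imports `Cruxes/…/Lines`.  COUNT-NEUTRAL.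

THE MATHEMATICS ([BernsteinZelevinsky1977, Thm. 5.2 = Geometrical Lemma 2.12 for the pair `(Q, Q)`, `Q = P₍₂,₁₎ ≤ GL₃`, §5–§7.1]; [Casselman1995, §6.3]).
`P = P₍₂,₁₎ = standardParabolicGL F ![0,0,1]`, `U = U_Q` its unipotent radical (root groups `(0,2)`, `(1,2)`), `N' = U_{P₍₁,₂₎}` (root groups `(0,1)`, `(0,2)`),
`w₀` the longest element, `σ'` a SMOOTH representation of `P` on `W`, `I = Ind_P^{GL₃} σ'` (★ `smoothIndRep`), `[f]_Q` the class of `f` in the `U`-coinvariants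
`(restrictUnipotentGL F ![0,0,1] I).Coinvariants`.  HYPOTHESIS (hW): `W` is spanned by the vectors `σ'(x₁₀(y)) w - w` («`W(X₁₀) = W`»; for `σ' = (σ ∘ proj) ⊗ δ^{1∕2}`
with `σ ≅ ρ ⊠ χ`, `ρ` supercuspidal on `GL₂(F)`, this is Harish-Chandra's criterion for `ρ` at the LOWER unipotent, brick BLK of K2E3-p21).  THEN:
**every `f ∈ I` with `f(1) = 0` has `[f]_Q = 0`** (`mk_eq_zero_of_toFun_one_eq_zero`), i.e. `I(U_Q) ⊇ {f : f|_P = 0}`; as evaluation at `1` kills `I(U_Q)` when `σ'`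
is trivial on `U` (`toFun_one_eq_zero_of_mk_eq_zero`), `r_Q(I) = I ∕ I(U_Q) ≅ W` via `f ↦ f(1)`, and `r_Q(I)` is IRREDUCIBLE as soon as `W` is irreducible under
`σ'|_{Levi}` (`isIrreducible_jacquetGL_twoOne`).  Proof of the key inclusion (the open orbit of the geometric lemma, Haar-free):
* (part 1, `K2E3GL3CuspidalBlockBoxes`) boxes `K(γ₁,γ₂) ≤ N'` and the SHEAR `x₁₂(y) · Φ_{K,w} = Φ_{K, σ'(x₁₀ y) w}` (`v(y) γ₁ ≤ γ₂`), whence `[Φ_{K, σ'(x₁₀ y) w - w}]_Q = 0`;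
* §3 `[Φ_{K,w}]_Q = 0` for EVERY compact open `K ≤ N'` and every `w` (hW + shrinking the box: ★ `cellSection_eq_sum_smoothIndRep`, the cosets `r = x₀₁(a) x₀₂(b)` act
  through `P` resp. `U`), hence `[f]_Q = 0` for `f ∈ I_open` (★ `exists_eq_sum_cellSection`) and for `f` vanishing on `P` (K0 chart decomposition `f = f₀ + (swap 0 1)·f₁`);
* §4 evaluation at `1` and the head `isIrreducible_jacquetGL_twoOne`.

HONEST LABEL: HC_CM is proved only modulo the 7 printed citations (2 remaining named inputs: hLiu418 = stmt-HodgeConjecture-24832, h413 = stmt-HodgeConjecture-24833)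
until rung 0 closes; count-neutral helper.

## Mathlib ∕ tree search
Tree (★, by name): `cellSection`, `cellSectionₗ`, `cellSection_congr`, `cellSection_eq_sum_smoothIndRep`, `smoothIndRep_cellSection_of_conj_mem`, `exists_eq_sum_cellSection`,
`cellSectionFun_eq_of_mem`, `conjSubgroup`, `mem_conjSubgroup_iff`, `coe_radicalConj_symm`, `exists_isLeftTransversal`, `IsLeftTransversal`, `exists_congruenceGL_subset_of_isOpen`,
`exists_congruenceGL_subset`, `Zelevinsky1980.mem_congruenceGL_iff_of_mem_oppositeCellRadical`, `isCompact_congruenceGL`, `isClosed_oppositeCellRadical`,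
`toFun_w₀_mul_mul_of_mem_stabilizer`, `exists_pow_mul_mem`, `jacquetGL_mk`, `leviProjection_leviEmbeddingP_apply`; K0.  Mathlib: `Representation.Coinvariants.{mk, mk_eq_zero,
mk_self_apply, lift, induction_on}`, `Submodule.span_induction`, `Valuation.map_add`.  Dedup: `rg "CuspidalBlockJacquet|mk_eq_zero_of_toFun_one"` — none.

## References
* [BernsteinZelevinsky1977] I. N. Bernstein, A. V. Zelevinsky, *Induced representations of reductive 𝔭-adic groups I*, Ann. Sci. ÉNS 10 (1977), Prop. 1.9, 2.12, Thm. 5.2, §7.1.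
* [Casselman1995] W. Casselman, *Introduction to the theory of admissible representations of 𝔭-adic reductive groups* (1995), §6.3.
* [Zelevinsky1980] A. V. Zelevinsky, *Induced representations of reductive 𝔭-adic groups II*, Ann. Sci. ÉNS 13 (1980), §1, Thm. 4.2.
-/

set_option autoImplicit false
set_option linter.dupNamespace false

noncomputable section

open Matrix OrderDual

namespace Summit.HodgeConjecture.HodgeConjecture.Cruxes.H413.K2E3GL3CuspidalBlockJacquetSame

open Literature.NumberTheory.Automorphic K2E3GL3MaximalParabolicRelabel K2E3GL3CuspidalBlockBoxes
open ValuativeRel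

variable {F : Type*} [Field F] [ValuativeRel F] [TopologicalSpace F] [IsNonarchimedeanLocalField F]
  {W : Type*} [AddCommGroup W] [Module ℂ W]
  (σ' : Representation ℂ ↥(standardParabolicGL F (![0, 0, 1] : Fin 3 → Fin 2)) W)

/-! ## §3  Classes in the `U_Q`-coinvariants -/

section Classes

/-- Right translation by `u ∈ U_Q` does not change the class in the `U_Q`-coinvariants. [cite: BernsteinZelevinsky1977, §1.8] -/
theorem mk_smoothIndRep_of_mem_unipotentRadicalGL {u : GL (Fin 3) F} (hu : u ∈ unipotentRadicalGL F (![0, 0, 1] : Fin 3 → Fin 2))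
    (f : Representation.SmoothInd (standardParabolicGL F (![0, 0, 1] : Fin 3 → Fin 2)) σ') :
    Representation.Coinvariants.mk (Representation.restrictUnipotentGL F (![0, 0, 1] : Fin 3 → Fin 2)
        (Representation.smoothIndRep (standardParabolicGL F (![0, 0, 1] : Fin 3 → Fin 2)) σ'))
      (Representation.smoothIndRep (standardParabolicGL F (![0, 0, 1] : Fin 3 → Fin 2)) σ' u f) =
    Representation.Coinvariants.mk (Representation.restrictUnipotentGL F (![0, 0, 1] : Fin 3 → Fin 2)
        (Representation.smoothIndRep (standardParabolicGL F (![0, 0, 1] : Fin 3 → Fin 2)) σ')) f := by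
  obtain ⟨p, hp, hpu⟩ := Subgroup.mem_map.1 hu
  have := Representation.Coinvariants.mk_self_apply
    (Representation.restrictUnipotentGL F (![0, 0, 1] : Fin 3 → Fin 2) (Representation.smoothIndRep (standardParabolicGL F (![0, 0, 1] : Fin 3 → Fin 2)) σ')) ⟨p, hp⟩ f
  rw [← hpu]
  exact this

/-- Right translation by `p ∈ P` maps the kernel of `[·]_Q` to itself (`U_Q` is normal in `P`). [cite: BernsteinZelevinsky1977, §1.8] -/
theorem mk_smoothIndRep_eq_zero_of_mem {p : GL (Fin 3) F} (hp : p ∈ standardParabolicGL F (![0, 0, 1] : Fin 3 → Fin 2))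
    {f : Representation.SmoothInd (standardParabolicGL F (![0, 0, 1] : Fin 3 → Fin 2)) σ'}
    (hf : Representation.Coinvariants.mk (Representation.restrictUnipotentGL F (![0, 0, 1] : Fin 3 → Fin 2)
        (Representation.smoothIndRep (standardParabolicGL F (![0, 0, 1] : Fin 3 → Fin 2)) σ')) f = 0) :
    Representation.Coinvariants.mk (Representation.restrictUnipotentGL F (![0, 0, 1] : Fin 3 → Fin 2)
        (Representation.smoothIndRep (standardParabolicGL F (![0, 0, 1] : Fin 3 → Fin 2)) σ'))
      (Representation.smoothIndRep (standardParabolicGL F (![0, 0, 1] : Fin 3 → Fin 2)) σ' p f) = 0 := by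
  have h := Representation.toCoinvariants_mk
    ((Representation.smoothIndRep (standardParabolicGL F (![0, 0, 1] : Fin 3 → Fin 2)) σ').comp (standardParabolicGL F (![0, 0, 1] : Fin 3 → Fin 2)).subtype)
    (unipotentRadicalP F (![0, 0, 1] : Fin 3 → Fin 2)) ⟨p, hp⟩ f
  change Representation.Coinvariants.mk _ ((Representation.smoothIndRep (standardParabolicGL F (![0, 0, 1] : Fin 3 → Fin 2)) σ').comp
      (standardParabolicGL F (![0, 0, 1] : Fin 3 → Fin 2)).subtype ⟨p, hp⟩ f) = 0
  rw [← h]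
  change Representation.toCoinvariants _ _ ⟨p, hp⟩ (Representation.Coinvariants.mk
    (Representation.restrictUnipotentGL F (![0, 0, 1] : Fin 3 → Fin 2) (Representation.smoothIndRep (standardParabolicGL F (![0, 0, 1] : Fin 3 → Fin 2)) σ')) f) = 0
  rw [hf, map_zero]

/-- Right translation by `r = x₀₁(a) x₀₂(b) ∈ N'` maps the kernel of `[·]_Q` to itself (`x₀₂(b) ∈ U_Q`, `x₀₁(a) ∈ P`). [cite: BernsteinZelevinsky1977, §1.8] -/
theorem mk_smoothIndRep_eq_zero_of_mem_oppositeCellRadical {r : GL (Fin 3) F} (hr : r ∈ oppositeCellRadical (K := F) (![0, 0, 1] : Fin 3 → Fin 2))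
    {f : Representation.SmoothInd (standardParabolicGL F (![0, 0, 1] : Fin 3 → Fin 2)) σ'}
    (hf : Representation.Coinvariants.mk (Representation.restrictUnipotentGL F (![0, 0, 1] : Fin 3 → Fin 2)
        (Representation.smoothIndRep (standardParabolicGL F (![0, 0, 1] : Fin 3 → Fin 2)) σ')) f = 0) :
    Representation.Coinvariants.mk (Representation.restrictUnipotentGL F (![0, 0, 1] : Fin 3 → Fin 2)
        (Representation.smoothIndRep (standardParabolicGL F (![0, 0, 1] : Fin 3 → Fin 2)) σ'))
      (Representation.smoothIndRep (standardParabolicGL F (![0, 0, 1] : Fin 3 → Fin 2)) σ' r f) = 0 := by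
  rw [eq_transvectionUnit_mul_of_mem_oppositeCellRadical hr, map_mul, Module.End.mul_apply]
  exact mk_smoothIndRep_eq_zero_of_mem σ' (transvectionUnit_zero_one_mem_standardParabolicGL _)
    (by rw [mk_smoothIndRep_of_mem_unipotentRadicalGL σ' (transvectionUnit_zero_two_mem_unipotentRadicalGL _)]; exact hf)

/-- **`[Φ_{K,w}]_Q = 0` for all boxes `K` small with respect to `w`** (the property propagated along the span in hW): for `w` in the span of the `σ'(x₁₀ y) v - v` there is a
finite set `ys` such that `[Φ_{K(γ₁,γ₂), w}]_Q = 0` whenever `v(y) γ₁ ≤ γ₂` for all `y ∈ ys` — on a generator, `Φ_{K, σ'(x₁₀ y) v - v} = x₁₂(y)·Φ_{K,v} - Φ_{K,v}` by §2.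
[cite: BernsteinZelevinsky1977, Thm. 5.2] -/
theorem exists_finset_mk_cellSection_eq_zero (hσ' : σ'.IsSmooth) {w : W}
    (hw : w ∈ Submodule.span ℂ {x : W | ∃ (y : F) (v : W), x = σ' ⟨transvectionUnit 1 0 (by decide) y, transvectionUnit_one_zero_mem_standardParabolicGL y⟩ v - v}) :
    ∃ ys : Finset F, ∀ {γ₁ γ₂ : ValueGroupWithZero F}, (∀ y ∈ ys, valuation F y * γ₁ ≤ γ₂) →
      ∀ (K : Subgroup ↥(oppositeCellRadical (K := F) (![0, 0, 1] : Fin 3 → Fin 2)))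
        (hKo : IsOpen (K : Set ↥(oppositeCellRadical (K := F) (![0, 0, 1] : Fin 3 → Fin 2))))
        (hKc : IsCompact (K : Set ↥(oppositeCellRadical (K := F) (![0, 0, 1] : Fin 3 → Fin 2)))),
        (∀ x : ↥(oppositeCellRadical (K := F) (![0, 0, 1] : Fin 3 → Fin 2)), x ∈ K ↔
          valuation F (((x : GL (Fin 3) F) : Matrix (Fin 3) (Fin 3) F) 0 1) ≤ γ₁ ∧ valuation F (((x : GL (Fin 3) F) : Matrix (Fin 3) (Fin 3) F) 0 2) ≤ γ₂) →
        Representation.Coinvariants.mk (Representation.restrictUnipotentGL F (![0, 0, 1] : Fin 3 → Fin 2)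
            (Representation.smoothIndRep (standardParabolicGL F (![0, 0, 1] : Fin 3 → Fin 2)) σ'))
          (cellSection σ' monotone_twoOne hσ' K hKo hKc w) = 0 := by
  classical
  induction hw using Submodule.span_induction with
  | mem x hx =>
    obtain ⟨y, v, rfl⟩ := hx
    refine ⟨{y}, fun hys K hKo hKc hK => ?_⟩
    have hy := hys y (Finset.mem_singleton_self y)
    have hlin := (cellSectionₗ σ' monotone_twoOne hσ' K hKo hKc).map_sub
      (σ' ⟨transvectionUnit 1 0 (by decide) y, transvectionUnit_one_zero_mem_standardParabolicGL y⟩ v) v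
    simp only [cellSectionₗ_apply] at hlin
    rw [hlin, map_sub, ← smoothIndRep_transvectionUnit_one_two_cellSection σ' hσ' hy K hKo hKc hK v,
      mk_smoothIndRep_of_mem_unipotentRadicalGL σ' (transvectionUnit_one_two_mem_unipotentRadicalGL y), sub_self]
  | zero =>
    refine ⟨∅, fun _ K hKo hKc _ => ?_⟩
    have h0 := (cellSectionₗ σ' monotone_twoOne hσ' K hKo hKc).map_zero
    simp only [cellSectionₗ_apply] at h0
    rw [h0, map_zero]
  | add x x' _ _ hx hx' =>
    obtain ⟨ys, hys⟩ := hx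
    obtain ⟨ys', hys'⟩ := hx'
    refine ⟨ys ∪ ys', fun h K hKo hKc hK => ?_⟩
    have hlin := (cellSectionₗ σ' monotone_twoOne hσ' K hKo hKc).map_add x x'
    simp only [cellSectionₗ_apply] at hlin
    rw [hlin, map_add, hys (fun y hy => h y (Finset.mem_union_left _ hy)) K hKo hKc hK,
      hys' (fun y hy => h y (Finset.mem_union_right _ hy)) K hKo hKc hK, add_zero]
  | smul a x _ hx =>
    obtain ⟨ys, hys⟩ := hx
    refine ⟨ys, fun h K hKo hKc hK => ?_⟩
    have hlin := (cellSectionₗ σ' monotone_twoOne hσ' K hKo hKc).map_smul a x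
    simp only [cellSectionₗ_apply] at hlin
    rw [hlin, map_smul, hys h K hKo hKc hK, smul_zero]

/-- **`[Φ_{K,w}]_Q = 0` FOR EVERY COMPACT OPEN `K ≤ N'` AND EVERY `w`** (under hW): shrink to a box `K(γ₁,γ₂) ≤ K` adapted to `w` and use the coset decomposition
`Φ_{K,w} = ∑_r r · Φ_{K(γ₁,γ₂),w}` (★ `cellSection_eq_sum_smoothIndRep`), the cosets acting through `P` and `U_Q`. [cite: BernsteinZelevinsky1977, Thm. 5.2] -/
theorem mk_cellSection_eq_zero (hσ' : σ'.IsSmooth)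
    (hW : ∀ w : W, w ∈ Submodule.span ℂ {x : W | ∃ (y : F) (v : W),
      x = σ' ⟨transvectionUnit 1 0 (by decide) y, transvectionUnit_one_zero_mem_standardParabolicGL y⟩ v - v})
    (K : Subgroup ↥(oppositeCellRadical (K := F) (![0, 0, 1] : Fin 3 → Fin 2)))
    (hKo : IsOpen (K : Set ↥(oppositeCellRadical (K := F) (![0, 0, 1] : Fin 3 → Fin 2))))
    (hKc : IsCompact (K : Set ↥(oppositeCellRadical (K := F) (![0, 0, 1] : Fin 3 → Fin 2)))) (w : W) :
    Representation.Coinvariants.mk (Representation.restrictUnipotentGL F (![0, 0, 1] : Fin 3 → Fin 2)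
        (Representation.smoothIndRep (standardParabolicGL F (![0, 0, 1] : Fin 3 → Fin 2)) σ'))
      (cellSection σ' monotone_twoOne hσ' K hKo hKc w) = 0 := by
  classical
  obtain ⟨ys, hys⟩ := exists_finset_mk_cellSection_eq_zero σ' hσ' (hW w)
  obtain ⟨γ₁, γ₂, hγ₁, h₁₂, hγ₂, hysγ, hKsub⟩ := exists_gauge K hKo ys
  obtain ⟨Ks, hKso, hKsc, hKs⟩ := exists_box (F := F) hγ₁ h₁₂ hγ₂
  have hle : Ks ≤ K := fun x hx => hKsub x ((hKs x).1 hx).1 ((hKs x).1 hx).2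
  obtain ⟨R, hR⟩ := exists_isLeftTransversal (B := K) hKc hKso
  rw [inf_eq_right.2 hle] at hR
  rw [cellSection_eq_sum_smoothIndRep monotone_twoOne hσ' hle hKo hKc hKso hKsc hR w, map_sum]
  refine Finset.sum_eq_zero fun r _ => ?_
  exact mk_smoothIndRep_eq_zero_of_mem_oppositeCellRadical σ' r.2 (hys hysγ Ks hKso hKsc hKs)

/-- **`[f]_Q = 0` FOR `f ∈ I_open`** (functions vanishing off the open cell `P w₀ U₃`): `f = ∑_r r⁻¹ · Φ_{r K' r⁻¹, f(w₀ r)}` (★ `exists_eq_sum_cellSection`).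
[cite: BernsteinZelevinsky1977, Thm. 5.2] -/
theorem mk_eq_zero_of_mem_vanishingOn (hσ' : σ'.IsSmooth)
    (hW : ∀ w : W, w ∈ Submodule.span ℂ {x : W | ∃ (y : F) (v : W),
      x = σ' ⟨transvectionUnit 1 0 (by decide) y, transvectionUnit_one_zero_mem_standardParabolicGL y⟩ v - v})
    (f : Representation.SmoothInd (standardParabolicGL F (![0, 0, 1] : Fin 3 → Fin 2)) σ')
    (hf : f ∈ vanishingOn (standardParabolicGL F (![0, 0, 1] : Fin 3 → Fin 2)) σ' (cellLT (K := F) (![0, 0, 1] : Fin 3 → Fin 2) Fin.revPerm)) :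
    Representation.Coinvariants.mk (Representation.restrictUnipotentGL F (![0, 0, 1] : Fin 3 → Fin 2)
        (Representation.smoothIndRep (standardParabolicGL F (![0, 0, 1] : Fin 3 → Fin 2)) σ')) f = 0 := by
  classical
  -- a compact open `K' ≤ N'` inside the stabiliser of `f`
  obtain ⟨γ, hγ⟩ := exists_congruenceGL_subset
    ((Representation.isSmooth_smoothInd (standardParabolicGL F (![0, 0, 1] : Fin 3 → Fin 2)) σ' f).mem_nhds (Subgroup.one_mem _))
  set K' : Subgroup ↥(oppositeCellRadical (K := F) (![0, 0, 1] : Fin 3 → Fin 2)) :=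
    (congruenceGL 3 (γ : ValueGroupWithZero F)).comap (oppositeCellRadical (K := F) (![0, 0, 1] : Fin 3 → Fin 2)).subtype with hK'
  have hK'o : IsOpen (K' : Set ↥(oppositeCellRadical (K := F) (![0, 0, 1] : Fin 3 → Fin 2))) :=
    (isOpen_congruenceGL γ.ne_zero).preimage continuous_subtype_val
  have hK'c : IsCompact (K' : Set ↥(oppositeCellRadical (K := F) (![0, 0, 1] : Fin 3 → Fin 2))) :=
    (isClosed_oppositeCellRadical (c := (![0, 0, 1] : Fin 3 → Fin 2))).isClosedEmbedding_subtypeVal.isCompact_preimage (isCompact_congruenceGL _)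
  have hK'stab : ∀ k ∈ K', ∀ x : GL (Fin 3) F, f.toFun (x * (k : GL (Fin 3) F)) = f.toFun x :=
    fun k hk x => toFun_w₀_mul_mul_of_mem_stabilizer (hγ hk) x
  obtain ⟨R, hR⟩ := exists_eq_sum_cellSection σ' monotone_twoOne hσ' K' hK'o hK'c f hf hK'stab
  rw [hR, map_sum]
  refine Finset.sum_eq_zero fun r _ => ?_
  exact mk_smoothIndRep_eq_zero_of_mem_oppositeCellRadical σ' (Subgroup.inv_mem _ r.2) (mk_cellSection_eq_zero σ' hσ' hW _ _ _ _)

/-- **JM-A, MAIN: `[f]_Q = 0` FOR EVERY `f ∈ Ind_{P₍₂,₁₎}^{GL₃} σ'` WITH `f(1) = 0`** (under hW).  Such an `f` vanishes on `P`, so it is `f₀ + (swap 0 1) · f₁` with `f₀`,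
`f₁ ∈ I_open` (K0 chart decomposition), and `swap 0 1` lies in the Levi of `P`.  Equivalently: the kernel of `r_Q` on `I = i_Q σ'` contains the kernel of evaluation at
`1` — the closed-orbit term of the geometric lemma for `(Q, Q)` is everything, the open-orbit term contributes nothing. [cite: BernsteinZelevinsky1977, Thm. 5.2]
[cite: Zelevinsky1980, §1, Thm. 4.2] -/
theorem mk_eq_zero_of_toFun_one_eq_zero (hσ' : σ'.IsSmooth)
    (hW : ∀ w : W, w ∈ Submodule.span ℂ {x : W | ∃ (y : F) (v : W),
      x = σ' ⟨transvectionUnit 1 0 (by decide) y, transvectionUnit_one_zero_mem_standardParabolicGL y⟩ v - v})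
    (f : Representation.SmoothInd (standardParabolicGL F (![0, 0, 1] : Fin 3 → Fin 2)) σ') (hf : f.toFun 1 = 0) :
    Representation.Coinvariants.mk (Representation.restrictUnipotentGL F (![0, 0, 1] : Fin 3 → Fin 2)
        (Representation.smoothIndRep (standardParabolicGL F (![0, 0, 1] : Fin 3 → Fin 2)) σ')) f = 0 := by
  obtain ⟨fi, hfi, hsum⟩ := exists_sum_smoothIndRep_swap_of_forall_toFun_eq_zero σ' f ((forall_toFun_eq_zero_iff_toFun_one σ' f).2 hf)
  rw [hsum, map_sum]
  refine Finset.sum_eq_zero fun i _ => mk_smoothIndRep_eq_zero_of_mem σ' ?_ (mk_eq_zero_of_mem_vanishingOn σ' hσ' hW (fi i) (hfi i))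
  exact permGL_mem_standardParabolicGL _ fun j => by fin_cases i <;> fin_cases j <;> decide

end Classes

/-! ## §4  Evaluation at `1` and the head: `r_Q(i_Q σ') ≅ σ'` is irreducible -/

section Eval

/-- **Evaluation at `1` kills `I(U_Q)`** when `σ'` is trivial on `U_Q`: `[f]_Q = 0 ⇒ f(1) = 0` (the generators `u·g - g` have `(u·g)(1) = g(u) = σ'(u) g(1) = g(1)`).
[cite: BernsteinZelevinsky1977, §1.8] -/
theorem toFun_one_eq_zero_of_mk_eq_zero
    (htriv : ∀ u : ↥(standardParabolicGL F (![0, 0, 1] : Fin 3 → Fin 2)), u ∈ unipotentRadicalP F (![0, 0, 1] : Fin 3 → Fin 2) → ∀ w : W, σ' u w = w)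
    (f : Representation.SmoothInd (standardParabolicGL F (![0, 0, 1] : Fin 3 → Fin 2)) σ')
    (hf : Representation.Coinvariants.mk (Representation.restrictUnipotentGL F (![0, 0, 1] : Fin 3 → Fin 2)
        (Representation.smoothIndRep (standardParabolicGL F (![0, 0, 1] : Fin 3 → Fin 2)) σ')) f = 0) :
    f.toFun 1 = 0 := by
  rw [Representation.Coinvariants.mk_eq_zero] at hf
  -- evaluation at `1` as a linear map, vanishing on the generators of the kernel
  let ev : Representation.SmoothInd (standardParabolicGL F (![0, 0, 1] : Fin 3 → Fin 2)) σ' →ₗ[ℂ] W :=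
    { toFun := fun g => g.toFun 1
      map_add' := fun g g' => by rw [Representation.SmoothInd.toFun_add]; rfl
      map_smul' := fun a g => by rw [Representation.SmoothInd.toFun_smul]; rfl }
  have hev : ∀ g, ev g = g.toFun 1 := fun _ => rfl
  suffices h : Representation.Coinvariants.ker (Representation.restrictUnipotentGL F (![0, 0, 1] : Fin 3 → Fin 2)
      (Representation.smoothIndRep (standardParabolicGL F (![0, 0, 1] : Fin 3 → Fin 2)) σ')) ≤ LinearMap.ker ev by
    have := h hf
    rwa [LinearMap.mem_ker, hev] at this
  rw [Representation.Coinvariants.ker, Submodule.span_le]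
  rintro _ ⟨⟨u, g⟩, rfl⟩
  rw [SetLike.mem_coe, LinearMap.mem_ker, map_sub, hev, hev, sub_eq_zero]
  change (Representation.smoothIndRep (standardParabolicGL F (![0, 0, 1] : Fin 3 → Fin 2)) σ' ((u : ↥(standardParabolicGL F (![0, 0, 1] : Fin 3 → Fin 2))) : GL (Fin 3) F) g).toFun 1 = g.toFun 1
  rw [Representation.toFun_smoothIndRep_apply, one_mul, ← mul_one (((u : ↥(standardParabolicGL F (![0, 0, 1] : Fin 3 → Fin 2))) : GL (Fin 3) F)),
    Representation.SmoothInd.toFun_subgroup_mul, htriv _ u.2]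

/-- **Every vector is a value at `1`**: `(w₀ · Φ_{K,w})(1) = Φ_{K,w}(w₀) = w` for any compact open `K ≤ N'`. [cite: BernsteinZelevinsky1977, §2.3] -/
theorem exists_toFun_one_eq (hσ' : σ'.IsSmooth) (w : W) : ∃ f : Representation.SmoothInd (standardParabolicGL F (![0, 0, 1] : Fin 3 → Fin 2)) σ', f.toFun 1 = w := by
  obtain ⟨ϖ, hϖ⟩ := exists_isUniformizingElement (F := F)
  have hv0 : valuation F ϖ ≠ 0 := (Valuation.ne_zero_iff _).mpr hϖ.ne_zero
  obtain ⟨K, hKo, hKc, hK⟩ := exists_box (F := F) hv0 le_rfl hϖ.valuation_lt_one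
  refine ⟨Representation.smoothIndRep (standardParabolicGL F (![0, 0, 1] : Fin 3 → Fin 2)) σ' (permGL Fin.revPerm) (cellSection σ' monotone_twoOne hσ' K hKo hKc w), ?_⟩
  have h1K : (1 : ↥(oppositeCellRadical (K := F) (![0, 0, 1] : Fin 3 → Fin 2))) ∈ K := K.one_mem
  rw [Representation.toFun_smoothIndRep_apply, one_mul, toFun_cellSection, ← one_mul (permGL Fin.revPerm : GL (Fin 3) F), ← mul_one (1 * permGL Fin.revPerm : GL (Fin 3) F),
    cellSectionFun_eq_of_mem monotone_twoOne w (Subgroup.one_mem _) (Subgroup.one_mem _) h1K]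
  change σ' 1 w = w
  rw [map_one, Module.End.one_apply]

/-- **JM-A, HEAD: `r_Q(i_Q σ')` IS IRREDUCIBLE.**  For `σ'` smooth on `P = P₍₂,₁₎`, trivial on `U_Q`, with `W = W(X₁₀)` (hW), non-zero and IRREDUCIBLE under the Levi
(`hirr`: the only subspaces stable under all `σ'(diag m)`, `m ∈ GL₂(F) × GL₁(F)`, are `⊥` and `⊤`), the Jacquet module `jacquetGL F ![0,0,1] (Ind_P^{GL₃} σ')` (the
`U_Q`-coinvariants with the Levi acting through block diagonal matrices) is irreducible: evaluation at `1` descends to a Levi-equivariant linear ISOMORPHISM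
`r_Q(I) ≅ W` (injective by `mk_eq_zero_of_toFun_one_eq_zero`, surjective by `exists_toFun_one_eq`).  For `σ' = (σ ∘ proj) ⊗ δ^{1∕2}` with `σ` irreducible supercuspidal
this is `r_Q(ρ × χ) ≅ (ρ ⊠ χ) ⊗ δ^{1∕2}` ([BernsteinZelevinsky1977, 2.12 for `(Q,Q)`]: of the two `(Q,Q)`-double cosets only the closed one contributes).
[cite: BernsteinZelevinsky1977, Thm. 5.2] [cite: Zelevinsky1980, §1, Thm. 4.2] -/
theorem isIrreducible_jacquetGL_twoOne (hσ' : σ'.IsSmooth) [Nontrivial W]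
    (htriv : ∀ u : ↥(standardParabolicGL F (![0, 0, 1] : Fin 3 → Fin 2)), u ∈ unipotentRadicalP F (![0, 0, 1] : Fin 3 → Fin 2) → ∀ w : W, σ' u w = w)
    (hW : ∀ w : W, w ∈ Submodule.span ℂ {x : W | ∃ (y : F) (v : W),
      x = σ' ⟨transvectionUnit 1 0 (by decide) y, transvectionUnit_one_zero_mem_standardParabolicGL y⟩ v - v})
    (hirr : ∀ Y : Submodule ℂ W, (∀ (m : Π a, GL {i // (![0, 0, 1] : Fin 3 → Fin 2) i = a} F) (y : W), y ∈ Y →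
      σ' (leviEmbeddingP F (![0, 0, 1] : Fin 3 → Fin 2) m) y ∈ Y) → Y = ⊥ ∨ Y = ⊤) :
    (Representation.jacquetGL F (![0, 0, 1] : Fin 3 → Fin 2) (Representation.smoothIndRep (standardParabolicGL F (![0, 0, 1] : Fin 3 → Fin 2)) σ')).IsIrreducible := by
  -- evaluation at `1` descends to the coinvariants
  let ev : Representation.SmoothInd (standardParabolicGL F (![0, 0, 1] : Fin 3 → Fin 2)) σ' →ₗ[ℂ] W :=
    { toFun := fun g => g.toFun 1
      map_add' := fun g g' => by rw [Representation.SmoothInd.toFun_add]; rfl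
      map_smul' := fun a g => by rw [Representation.SmoothInd.toFun_smul]; rfl }
  have hev : ∀ g, ev g = g.toFun 1 := fun _ => rfl
  have hevρ : ∀ u : ↥(unipotentRadicalP F (![0, 0, 1] : Fin 3 → Fin 2)),
      ev ∘ₗ Representation.restrictUnipotentGL F (![0, 0, 1] : Fin 3 → Fin 2)
        (Representation.smoothIndRep (standardParabolicGL F (![0, 0, 1] : Fin 3 → Fin 2)) σ') u = ev := by
    intro u
    refine LinearMap.ext fun g => ?_
    rw [LinearMap.comp_apply, hev, hev]
    change (Representation.smoothIndRep (standardParabolicGL F (![0, 0, 1] : Fin 3 → Fin 2)) σ'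
      ((u : ↥(standardParabolicGL F (![0, 0, 1] : Fin 3 → Fin 2))) : GL (Fin 3) F) g).toFun 1 = g.toFun 1
    rw [Representation.toFun_smoothIndRep_apply, one_mul, ← mul_one (((u : ↥(standardParabolicGL F (![0, 0, 1] : Fin 3 → Fin 2))) : GL (Fin 3) F)),
      Representation.SmoothInd.toFun_subgroup_mul, htriv _ u.2]
  set E : (Representation.restrictUnipotentGL F (![0, 0, 1] : Fin 3 → Fin 2)
      (Representation.smoothIndRep (standardParabolicGL F (![0, 0, 1] : Fin 3 → Fin 2)) σ')).Coinvariants →ₗ[ℂ] W :=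
    Representation.Coinvariants.lift _ ev hevρ with hEdef
  have hE : ∀ g, E (Representation.Coinvariants.mk _ g) = g.toFun 1 := fun g => by
    rw [hEdef, Representation.Coinvariants.lift_mk]; exact hev g
  -- `E` is injective and surjective
  have hEinj : ∀ x, E x = 0 → x = 0 := by
    intro x hx
    induction x using Representation.Coinvariants.induction_on with
    | h g =>
      rw [hE] at hx
      exact mk_eq_zero_of_toFun_one_eq_zero σ' hσ' hW g hx
  have hEsurj : Function.Surjective E := fun w => by
    obtain ⟨f, hf⟩ := exists_toFun_one_eq σ' hσ' w
    exact ⟨Representation.Coinvariants.mk _ f, by rw [hE, hf]⟩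
  -- `E` intertwines the Levi actions: `E (m · x) = σ'(diag m) (E x)`
  have hEm : ∀ (m : Π a, GL {i // (![0, 0, 1] : Fin 3 → Fin 2) i = a} F)
      (x : (Representation.restrictUnipotentGL F (![0, 0, 1] : Fin 3 → Fin 2)
        (Representation.smoothIndRep (standardParabolicGL F (![0, 0, 1] : Fin 3 → Fin 2)) σ')).Coinvariants),
      E (Representation.jacquetGL F (![0, 0, 1] : Fin 3 → Fin 2) (Representation.smoothIndRep (standardParabolicGL F (![0, 0, 1] : Fin 3 → Fin 2)) σ') m x) =
        σ' (leviEmbeddingP F (![0, 0, 1] : Fin 3 → Fin 2) m) (E x) := by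
    intro m x
    induction x using Representation.Coinvariants.induction_on with
    | h g =>
      rw [Representation.jacquetGL_mk, hE, hE, Representation.toFun_smoothIndRep_apply, one_mul, ← coe_leviEmbeddingP,
        ← mul_one ((leviEmbeddingP F (![0, 0, 1] : Fin 3 → Fin 2) m : GL (Fin 3) F)), Representation.SmoothInd.toFun_subgroup_mul]
  -- non-triviality of the coinvariants
  haveI : Nontrivial (Representation.restrictUnipotentGL F (![0, 0, 1] : Fin 3 → Fin 2)
      (Representation.smoothIndRep (standardParabolicGL F (![0, 0, 1] : Fin 3 → Fin 2)) σ')).Coinvariants := by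
    obtain ⟨w, hw⟩ := exists_ne (0 : W)
    obtain ⟨x, hx⟩ := hEsurj w
    exact ⟨⟨x, 0, fun h => hw (by rw [← hx, h, map_zero])⟩⟩
  haveI : Nontrivial (Subrepresentation (Representation.jacquetGL F (![0, 0, 1] : Fin 3 → Fin 2)
      (Representation.smoothIndRep (standardParabolicGL F (![0, 0, 1] : Fin 3 → Fin 2)) σ'))) :=
    ⟨⟨⊥, ⊤, fun h => bot_ne_top (α := Submodule ℂ (Representation.restrictUnipotentGL F (![0, 0, 1] : Fin 3 → Fin 2)
      (Representation.smoothIndRep (standardParabolicGL F (![0, 0, 1] : Fin 3 → Fin 2)) σ')).Coinvariants) (congrArg Subrepresentation.toSubmodule h)⟩⟩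
  refine { eq_bot_or_eq_top := fun N => ?_ }
  -- the image of `N` under `E` is a Levi-stable subspace of `W`
  let Y : Submodule ℂ W := N.toSubmodule.map E
  have hY : ∀ (m : Π a, GL {i // (![0, 0, 1] : Fin 3 → Fin 2) i = a} F) (y : W), y ∈ Y → σ' (leviEmbeddingP F (![0, 0, 1] : Fin 3 → Fin 2) m) y ∈ Y := by
    rintro m _ ⟨x, hx, rfl⟩
    exact ⟨_, N.apply_mem_toSubmodule m hx, hEm m x⟩
  rcases hirr Y hY with h | h
  · left
    refine Subrepresentation.toSubmodule_injective ?_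
    change N.toSubmodule = ⊥
    refine le_bot_iff.1 fun x hx => (Submodule.mem_bot ℂ).2 (hEinj x ?_)
    have hx0 : E x ∈ Y := ⟨x, hx, rfl⟩
    rw [h, Submodule.mem_bot] at hx0
    exact hx0
  · right
    refine Subrepresentation.toSubmodule_injective ?_
    change N.toSubmodule = ⊤
    refine eq_top_iff.2 fun x _ => ?_
    have hx : E x ∈ Y := by rw [h]; exact Submodule.mem_top
    obtain ⟨x', hx', hxx'⟩ := hx
    have : x' = x := by
      have h0 : E (x' - x) = 0 := by rw [map_sub, hxx', sub_self]
      exact sub_eq_zero.1 (hEinj _ h0)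
    rw [← this]
    exact hx'

end Eval

end Summit.HodgeConjecture.HodgeConjecture.Cruxes.H413.K2E3GL3CuspidalBlockJacquetSame

end
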